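import Literature.AlgebraicGeometry.Resolution.BlowupChartRatios
import Literature.AlgebraicGeometry.Resolution.ExceptionalHostCharts
import HarnessLib

/-!
# The exceptional divisor over a closed subscheme of the centre: charts, ratios and their sections

Topic: `Literature/AlgebraicGeometry/Resolution`. Theorem-only file. Let `β : X' → M` be a blowing
up along the kernel `𝓘 = ker i₀` of a closed immersion `i₀ : B ↪ M` (universal property,
`IsBlowup`), `E = X' ×_M B` its exceptional divisor with `j = pr₁ : E ↪ X'`, `q = pr₂ : E → B`, and
`W ⊆ M` an affine open with sections `u, v, w ∈ 𝓘(W)`. Pulling back the principal charts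
`X'[W, u]` and the ratios `T_{uv} = β^*v/β^*u` (`BlowupChartRatios.lean`) along `j` gives on `E` the
opens `E_u = j⁻¹X'[W, u]` and the functions `j^*T_{uv} ∈ Γ(E, E_u)` satisfying the axioms of the
tree's `GeneratingSections` (Hartshorne II Thm. 7.1) — the sections `β^*u` of `𝒪_E(1)`, by which
`E` maps to the projective space over the centre (Hartshorne II Thm. 8.24 (b): `E ≅ ℙ(𝓘/𝓘²)`;
Liu Thm. 8.1.19 (b)):

* `iSup_preimage_fst_blowupChart` — the `E_{x_k}` at generators `x_k` of `𝓘(W)` cover `q⁻¹(i₀⁻¹W)`;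
* `basicOpen_fst_app_chartRatio` — `E_{(j^*T_{uv})} = E_u ∩ E_v`;
* `fst_app_chartRatio_mul` — the cocycle rule for the `j^*T_{uv}` on `E_u ∩ E_v`;
* `exists_ringEquiv_sections_preimage_fst_blowupChart` — **`Γ(E, E_u) ≅ A[𝓘(W)/u] / (u)`** with
  `j^*y ↦ ȳ` under `Γ(X', X'[W, u]) ≅ A[𝓘(W)/u]` (`A = Γ(M, W)`; so `q^*i₀^*a ↦ a/1`, `j^*T_{uv} ↦ v/u`).

## References

* [Hartshorne1977] R. Hartshorne, Algebraic Geometry (1977), II Thm. 7.1, II Thm. 8.24 (b).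
* [Liu2002] Q. Liu, Algebraic Geometry and Arithmetic Curves (2002), Thm. 8.1.19 (b).
* [StacksProject] The Stacks Project, Tag 0804, Tag 07Z3 (2).
-/

noncomputable section

open CategoryTheory CategoryTheory.Limits AlgebraicGeometry TopologicalSpace Opposite

namespace Literature.AlgebraicGeometry.Resolution

universe u

variable {X' M B : Scheme.{u}} {β : X' ⟶ M} {i₀ : B ⟶ M}

section Charts

variable (hβ : IsBlowup β i₀.ker) (W : M.affineOpens) {u v w : Γ(M, W)}

local notation3 "pb" u ", " s => Scheme.Hom.appLE β (W : M.Opens) (blowupChart β (Scheme.Hom.ker i₀) W u)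
  (blowupChart_le_preimage β (Scheme.Hom.ker i₀) W u) s

include hβ in
/-- **The pulled-back charts at generators of `𝓘(W)` cover `q⁻¹(i₀⁻¹ W)`** (`j ≫ β = q ≫ i₀` and the
`X'[W, x_k]` cover `β⁻¹W`, Stacks 0804). [cite: StacksProject, Tag 0804] -/
theorem iSup_preimage_fst_blowupChart {κ : Type*} (x : κ → Γ(M, W))
    (hx : Ideal.span (Set.range x) = i₀.ker.ideal W) :
    ⨆ k, pullback.fst β i₀ ⁻¹ᵁ blowupChart β i₀.ker W (x k) =
      pullback.snd β i₀ ⁻¹ᵁ (i₀ ⁻¹ᵁ (W : M.Opens)) := by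
  rw [← Scheme.Hom.preimage_iSup, hβ.iSup_blowupChart x hx, ← Scheme.Hom.comp_preimage,
    pullback.condition, Scheme.Hom.comp_preimage]

include hβ in
/-- **`E_{(j^*T_{uv})} = E_u ∩ E_v`**: pull back `D(T_{uv}) = X'[W, u] ∩ X'[W, v]`
(`IsBlowup.basicOpen_chartRatio`) along `j = pr₁`. [cite: StacksProject, Tag 0804] -/
theorem basicOpen_fst_app_chartRatio (hu : u ∈ i₀.ker.ideal W) (hv : v ∈ i₀.ker.ideal W)
    {T : Γ(X', blowupChart β i₀.ker W u)} (hT : (pb u, v) = (pb u, u) * T) :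
    (pullback β i₀).basicOpen ((pullback.fst β i₀).app (blowupChart β i₀.ker W u) T) =
      pullback.fst β i₀ ⁻¹ᵁ blowupChart β i₀.ker W u ⊓ pullback.fst β i₀ ⁻¹ᵁ blowupChart β i₀.ker W v := by
  rw [← Scheme.preimage_basicOpen, hβ.basicOpen_chartRatio W hu hv hT, Scheme.Hom.preimage_inf]

/-- Restricting a pulled-back section of `X'` over `V` to `j⁻¹V ∩ j⁻¹V'` is pulling back its restriction
to `V ∩ V'` (both written through `appLE` into `Γ(E, j⁻¹V ∩ j⁻¹V')`). [folklore] -/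
theorem map_fst_app_eq_appLE_map {V V' : X'.Opens} (y : Γ(X', V)) :
    (pullback β i₀).presheaf.map
        (homOfLE (inf_le_left : pullback.fst β i₀ ⁻¹ᵁ V ⊓ pullback.fst β i₀ ⁻¹ᵁ V' ≤ _)).op
        ((pullback.fst β i₀).app V y) =
      (pullback.fst β i₀).appLE (V ⊓ V') (pullback.fst β i₀ ⁻¹ᵁ V ⊓ pullback.fst β i₀ ⁻¹ᵁ V') le_rfl
        (X'.presheaf.map (homOfLE (inf_le_left : V ⊓ V' ≤ V)).op y) := by
  rw [← CommRingCat.comp_apply, ← CommRingCat.comp_apply, Scheme.Hom.app_eq_appLE,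
    Scheme.Hom.appLE_map, Scheme.Hom.map_appLE]

/-- The same for the right member of an intersection. [folklore] -/
theorem map_fst_app_eq_appLE_map' {V V' : X'.Opens} (y : Γ(X', V')) :
    (pullback β i₀).presheaf.map
        (homOfLE (inf_le_right : pullback.fst β i₀ ⁻¹ᵁ V ⊓ pullback.fst β i₀ ⁻¹ᵁ V' ≤ _)).op
        ((pullback.fst β i₀).app V' y) =
      (pullback.fst β i₀).appLE (V ⊓ V') (pullback.fst β i₀ ⁻¹ᵁ V ⊓ pullback.fst β i₀ ⁻¹ᵁ V') le_rfl
        (X'.presheaf.map (homOfLE (inf_le_right : V ⊓ V' ≤ V')).op y) := by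
  rw [← CommRingCat.comp_apply, ← CommRingCat.comp_apply, Scheme.Hom.app_eq_appLE,
    Scheme.Hom.appLE_map, Scheme.Hom.map_appLE]

include hβ in
/-- **The cocycle rule for the pulled-back ratios**: `j^*T_{uv} · j^*T_{vw} = j^*T_{uw}` on `E_u ∩ E_v`
(`IsBlowup.chartRatio_mul_chartRatio` pulled back along `j`). [cite: StacksProject, Tag 0804] -/
theorem fst_app_chartRatio_mul (hu : u ∈ i₀.ker.ideal W) (hv : v ∈ i₀.ker.ideal W)
    {Tuv : Γ(X', blowupChart β i₀.ker W u)} (hTuv : (pb u, v) = (pb u, u) * Tuv)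
    {Tvw : Γ(X', blowupChart β i₀.ker W v)} (hTvw : (pb v, w) = (pb v, v) * Tvw)
    {Tuw : Γ(X', blowupChart β i₀.ker W u)} (hTuw : (pb u, w) = (pb u, u) * Tuw) :
    (pullback β i₀).presheaf.map (homOfLE (inf_le_left :
          pullback.fst β i₀ ⁻¹ᵁ blowupChart β i₀.ker W u ⊓ pullback.fst β i₀ ⁻¹ᵁ blowupChart β i₀.ker W v ≤ _)).op
        ((pullback.fst β i₀).app (blowupChart β i₀.ker W u) Tuv) *
      (pullback β i₀).presheaf.map (homOfLE (inf_le_right :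
          pullback.fst β i₀ ⁻¹ᵁ blowupChart β i₀.ker W u ⊓ pullback.fst β i₀ ⁻¹ᵁ blowupChart β i₀.ker W v ≤ _)).op
        ((pullback.fst β i₀).app (blowupChart β i₀.ker W v) Tvw) =
      (pullback β i₀).presheaf.map (homOfLE (inf_le_left :
          pullback.fst β i₀ ⁻¹ᵁ blowupChart β i₀.ker W u ⊓ pullback.fst β i₀ ⁻¹ᵁ blowupChart β i₀.ker W v ≤ _)).op
        ((pullback.fst β i₀).app (blowupChart β i₀.ker W u) Tuw) := by
  rw [map_fst_app_eq_appLE_map, map_fst_app_eq_appLE_map', map_fst_app_eq_appLE_map, ← map_mul,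
    hβ.chartRatio_mul_chartRatio W hu hv hTuv hTvw hTuw]

end Charts

/-! ## The sections of `E` over a pulled-back chart -/

section Sections

variable [IsClosedImmersion i₀] (W : M.affineOpens) {u : Γ(M, W)}

/-- **`Γ(E, j⁻¹X'[W, u]) ≅ A[𝓘(W)/u] / (u)`.** For the exceptional divisor `E = X' ×_M B` of a blowing
up `β` along `𝓘 = ker i₀`, an affine open `W ⊆ M`, `u ∈ 𝓘(W)` and an `A = Γ(M, W)`-isomorphism
`e : Γ(X', X'[W, u]) ≅ A[𝓘(W)/u]` (`IsBlowup.exists_ringEquiv_blowupChart`), there is a ring isomorphism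
`ε : Γ(E, j⁻¹X'[W, u]) ≅ A[𝓘(W)/u] ⧸ (u/1)` with `ε(j^*y) = e(y) mod u`: `j` is a closed immersion with
`ker j = 𝓘 · 𝒪_{X'}`, which on the chart is the extension of `𝓘(W)`, i.e. `(u)` (Stacks 07Z3 (2)). Hence
`q^*(i₀^*a) ↦ a/1` and `j^*T_{uv} ↦ v/u` (`ringEquiv_chartRatio`): the affine pieces of `E` are the spectra
of the affine blowup algebras modulo the exceptional equation (Liu Thm. 8.1.19 (b)).
[cite: Liu2002, Thm. 8.1.19 (b)] [cite: StacksProject, Tag 07Z3 (2)] -/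
theorem exists_ringEquiv_sections_preimage_fst_blowupChart (hβ : IsBlowup β i₀.ker)
    (hu : u ∈ i₀.ker.ideal W)
    (e : Γ(X', blowupChart β i₀.ker W u) ≃+* blowupAlgebra (i₀.ker.ideal W) u)
    (he : ∀ s, e (β.appLE W (blowupChart β i₀.ker W u) (blowupChart_le_preimage β i₀.ker W u) s) =
      algebraMap Γ(M, W) (blowupAlgebra (i₀.ker.ideal W) u) s) :
    ∃ ε : Γ(pullback β i₀, pullback.fst β i₀ ⁻¹ᵁ blowupChart β i₀.ker W u) ≃+*
        (blowupAlgebra (i₀.ker.ideal W) u ⧸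
          Ideal.span {algebraMap Γ(M, W) (blowupAlgebra (i₀.ker.ideal W) u) u}),
      ∀ y, ε ((pullback.fst β i₀).app (blowupChart β i₀.ker W u) y) = Ideal.Quotient.mk _ (e y) := by
  have hCu : IsAffineOpen (blowupChart β i₀.ker W u) := hβ.isAffineOpen_blowupChart hu
  -- `Γ(E, j⁻¹ X'[W,u]) = Γ(X', X'[W,u]) / K·Γ` (`j` a closed immersion with `ker j = (ker i₀)·𝒪_{X'}`)
  have hjsurj : Function.Surjective ((pullback.fst β i₀).app (blowupChart β i₀.ker W u)) :=
    (pullback.fst β i₀).app_surjective _ hCu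
  have hjker : RingHom.ker ((pullback.fst β i₀).app (blowupChart β i₀.ker W u)).hom =
      (i₀.ker.ideal W).map (β.appLE W _ (blowupChart_le_preimage β i₀.ker W u)).hom := by
    rw [← Scheme.Hom.ker_apply (pullback.fst β i₀) ⟨_, hCu⟩,
      Scheme.IdealSheafData.ker_fst_of_isClosedImmersion,
      ideal_comap_of_le β i₀.ker W ⟨_, hCu⟩ (blowupChart_le_preimage β i₀.ker W u)]
  let ε₁ : Γ(pullback β i₀, pullback.fst β i₀ ⁻¹ᵁ blowupChart β i₀.ker W u) ≃+*
      Γ(X', blowupChart β i₀.ker W u) ⧸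
        (i₀.ker.ideal W).map (β.appLE W _ (blowupChart_le_preimage β i₀.ker W u)).hom :=
    ((RingHom.quotientKerEquivOfSurjective hjsurj).symm).trans (Ideal.quotEquivOfEq hjker)
  have hε₁ : ∀ y, ε₁ ((pullback.fst β i₀).app (blowupChart β i₀.ker W u) y) = Ideal.Quotient.mk _ y :=
      fun y ↦ by
    change Ideal.quotEquivOfEq hjker ((RingHom.quotientKerEquivOfSurjective hjsurj).symm _) = _
    have : (RingHom.quotientKerEquivOfSurjective hjsurj).symm
        ((pullback.fst β i₀).app (blowupChart β i₀.ker W u) y) = Ideal.Quotient.mk _ y := by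
      apply (RingHom.quotientKerEquivOfSurjective hjsurj).injective
      rw [RingEquiv.apply_symm_apply, RingHom.quotientKerEquivOfSurjective_apply_mk]
    rw [this, Ideal.quotEquivOfEq_mk]
  -- transport along `e`: `(K·Γ).map e = K · A[K/u] = (u/1)`
  have hKe : Ideal.span {algebraMap Γ(M, W) (blowupAlgebra (i₀.ker.ideal W) u) u} =
      ((i₀.ker.ideal W).map (β.appLE W _ (blowupChart_le_preimage β i₀.ker W u)).hom).map
        (e : _ →+* _) := by
    rw [Ideal.map_map, ← map_blowupAlgebra_eq_span hu]
    congr 1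
    exact RingHom.ext fun s ↦ (he s).symm
  let ε₂ := Ideal.quotientEquiv _ _ e hKe
  refine ⟨ε₁.trans ε₂, fun y ↦ ?_⟩
  rw [RingEquiv.trans_apply, hε₁]
  exact Ideal.quotientEquiv_mk _ _ e hKe y

end Sections

end Literature.AlgebraicGeometry.Resolution

end
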